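import Summits.QuantumFields.BalabanUV.Beta.GAN24.ArrowScaling
import Summits.QuantumFields.BalabanUV.Beta.GAN24.ArrowUnitBlock

/-!
# `BalabanUV.Beta.GAN24.ArrowScalingInv` — binder row G-an2-4 / (CONV-C), road P1-fibre, row **P1-L10** `FibreStrip` ((I3′)), cut «(M4) scaled alias-space
# Neumann, two anchors» = SKELETON-P1 A5 v0.3, module **F1e** (last currency piece): (i) the bridge `uBlock d = unitKKT d` ⇒ EVERY anchor block is
# invertible with inverse norm ≤ 5/2 (packaged for F3 = inner anchor, F5 = outer anchor); (ii) UNSCALING: for positive radii,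
# `(arrowMat (aliasArrow N p))⁻¹ = D_σ · (arrowMat (scaledArrow …))⁻¹ · D_ρ`, and the READOUT BOUND `|read ⬝ᵥ A⁻¹ src| ≤ ‖σ•read‖₂·‖F̃⁻¹‖·‖ρ•src‖₂` (row F8 (ii)).

NOT IN PRINT; OUR PROOF ATTEMPT (of the road; THIS file is [folklore] bookkeeping).  HONEST FRAMING (cell contract, verbatim): «discharging `BetaPertH` makes
Bałaban's UV stability UNCONDITIONAL — a real constructive-QFT result; it is NOT the continuum limit and NOT the Clay problem.»  HONEST DEPENDENCY (verbatim):
«continuum YM on T⁴ ⇐ BetaPertH ∧ nine spine estimates (0/9 proved); BetaPertH ⇐ (D1) ∧ (D4) ∧ CAP+tail; G-an2-4 gates asym, D1 and NE2/3/4.»  No cited fact,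
no wall binder, no `def … : Prop` hypothesis, no estimate; nothing of the K-slot of (CONV-C) is discharged here.  NOT summit progress.
-/

noncomputable section

open Matrix WithLp Complex Finset
open scoped Matrix.Norms.L2Operator InnerProductSpace BigOperators ComplexConjugate Real
open Literature.MathematicalPhysics.QuantumFieldTheory.Balaban1983to89
open Literature.Probability.LatticeModels (TorusSite)
open B4Strip (ofRealVec)
open Summit.QuantumFields.BalabanUV.Beta.GAN24.ArrowOperator
open Summit.QuantumFields.BalabanUV.Beta.GAN24.ArrowScaling
open Summit.QuantumFields.BalabanUV.Beta.GAN24.ArrowUnitBlock (unitKKT unitKKT_apply_inl_inl unitKKT_apply_inl_inr unitKKT_apply_inr_inl unitKKT_apply_inr_inr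
  isUnit_and_norm_inv_unitKKT_le)
open Summit.QuantumFields.BalabanUV.Beta.GAN24.BorderedFrameInverseBlocks (norm_star_dotProduct_le norm_toLp_star)
open Summit.QuantumFields.BalabanUV.Beta.GAN24.ArrowNorms (norm_toLp_mulVec_le)

namespace Summit.QuantumFields.BalabanUV.Beta.GAN24.ArrowScalingInv

variable {D : ℕ}

/-! ## §1 The bridge `uBlock = unitKKT` and the packaged anchor blocks -/

/-- [folklore] **BRIDGE**: the unit KKT block of `ArrowScaling` (a `tBlock`) IS `ArrowUnitBlock.unitKKT` (E1's frame model), entry by entry. -/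
theorem uBlock_eq_unitKKT (d : Fin D → ℂ) : uBlock d = unitKKT d := by
  ext i j
  rcases i with κ | u <;> rcases j with l | u'
  · rw [unitKKT_apply_inl_inl]; simp [uBlock, tBlock, mul_comm]
  · rw [unitKKT_apply_inl_inr]; simp [uBlock, tBlock]
  · rw [unitKKT_apply_inr_inl]; simp [uBlock, tBlock]
  · rw [unitKKT_apply_inr_inr]; simp [uBlock, tBlock]

/-- [folklore] `uBlock d` is invertible with `‖(uBlock d)⁻¹‖ ≤ 5/2` whenever `Σ_κ ‖d κ‖² = 1`. -/
theorem isUnit_and_norm_inv_uBlock_le {d : Fin D → ℂ} (h : ∑ κ, ‖d κ‖ ^ 2 = 1) : IsUnit (uBlock d) ∧ ‖(uBlock d)⁻¹‖ ≤ 5 / 2 := by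
  rw [uBlock_eq_unitKKT]; exact isUnit_and_norm_inv_unitKKT_le h

variable {N : ℕ} [NeZero N]

/-- [folklore] **OUTER ANCHOR BLOCKS** (row F5, constant `tB = 5/2`): for `q ∈ [−π,π]^D ∖ {0}` EVERY block of `outerArrow N q (ofRealVec q)` is invertible with
inverse norm ≤ 5/2. -/
theorem outer_blocks {q : Fin D → ℝ} (hq : ∀ i, |q i| ≤ π) (hq0 : q ≠ 0) (m : TorusSite D N) :
    IsUnit ((outerArrow N q (ofRealVec q)).T m) ∧ ‖((outerArrow N q (ofRealVec q)).T m)⁻¹‖ ≤ 5 / 2 := by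
  rw [outerArrow, scaledArrow_T_ofRealVec (radO_pos hq hq0)]
  exact isUnit_and_norm_inv_uBlock_le (sum_norm_sq_unitSym (radO_pos hq hq0 m))

/-- [folklore] **INNER ANCHOR BLOCKS** (row F3): for `m ≠ 0` the block of `innerArrow N 0` is invertible with inverse norm ≤ 5/2 (and the `m = 0` block is `0`,
`ArrowScaling.innerArrow_T_zero_zero`). -/
theorem inner_blocks_of_ne {m : TorusSite D N} (hm : m ≠ 0) :
    IsUnit ((innerArrow N (0 : Fin D → ℂ)).T m) ∧ ‖((innerArrow N (0 : Fin D → ℂ)).T m)⁻¹‖ ≤ 5 / 2 := by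
  rw [innerArrow_T_zero_of_ne hm]
  exact isUnit_and_norm_inv_uBlock_le (sum_norm_sq_unitSym (radO_zero_pos_of_ne hm))

/-! ## §2 Unscaling the inverse and the readout bound (row F8 (ii)) -/

section Unscale

variable {ι : Type*} [Fintype ι] [DecidableEq ι]

/-- [folklore] The scaling weight vectors are invertible diagonals when all weights are nonzero; then
`(arrowMat X)⁻¹ = D_σ · (arrowMat (X.scale …))⁻¹ · D_ρ`. -/
theorem inv_arrowMat_eq_of_scale (X : ArrowData D ι) {ρl : ι → Loc D → ℝ} {ρb : Loc D → ℝ} {σl : ι → Loc D → ℝ} {σb : Loc D → ℝ}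
    (hρ : ∀ i, rowVec ρl ρb i ≠ 0) (hσ : ∀ i, colVec σl σb i ≠ 0) (hU : IsUnit (arrowMat (X.scale ρl ρb σl σb))) :
    (arrowMat X)⁻¹ = diagonal (colVec σl σb) * (arrowMat (X.scale ρl ρb σl σb))⁻¹ * diagonal (rowVec ρl ρb) := by
  have hDρ : IsUnit (diagonal (rowVec ρl ρb)).det := (isUnit_iff_isUnit_det _).1 (isUnit_diagonal_of_ne_zero hρ)
  have hDσ : IsUnit (diagonal (colVec σl σb)).det := (isUnit_iff_isUnit_det _).1 (isUnit_diagonal_of_ne_zero hσ)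
  have hX : IsUnit (arrowMat X) := (isUnit_arrowMat_scale_iff X hρ hσ).1 hU
  have hXdet : IsUnit (arrowMat X).det := (isUnit_iff_isUnit_det _).1 hX
  refine Matrix.inv_eq_right_inv ?_
  -- A · (D_σ F̃⁻¹ D_ρ) = 1, using F̃ = D_ρ A D_σ
  have hF := arrowMat_scale X ρl ρb σl σb
  have hFdet : IsUnit (arrowMat (X.scale ρl ρb σl σb)).det := (isUnit_iff_isUnit_det _).1 hU
  calc arrowMat X * (diagonal (colVec σl σb) * (arrowMat (X.scale ρl ρb σl σb))⁻¹ * diagonal (rowVec ρl ρb))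
      = (diagonal (rowVec ρl ρb))⁻¹ * (diagonal (rowVec ρl ρb) * arrowMat X * diagonal (colVec σl σb)) *
          (arrowMat (X.scale ρl ρb σl σb))⁻¹ * diagonal (rowVec ρl ρb) := by
        rw [← Matrix.mul_assoc, ← Matrix.mul_assoc]
        congr 2
        rw [← Matrix.mul_assoc, ← Matrix.mul_assoc, nonsing_inv_mul _ hDρ, Matrix.one_mul]
    _ = 1 := by
        rw [← hF, Matrix.mul_assoc ((diagonal (rowVec ρl ρb))⁻¹), mul_nonsing_inv _ hFdet, Matrix.mul_one, nonsing_inv_mul _ hDρ]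

/-- [folklore] `diagonal v *ᵥ w = v * w` (pointwise). -/
theorem diagonal_mulVec_eq {n : Type*} [Fintype n] [DecidableEq n] (v w : n → ℂ) : diagonal v *ᵥ w = fun i => v i * w i := by
  funext i; rw [mulVec_diagonal]

/-- [folklore] **UNSCALED SOLUTION = SCALED SOLUTION, REWEIGHTED**: `(arrowMat X)⁻¹ src = σ • ((arrowMat X̃)⁻¹ (ρ • src))` pointwise. -/
theorem inv_mulVec_eq_of_scale (X : ArrowData D ι) {ρl : ι → Loc D → ℝ} {ρb : Loc D → ℝ} {σl : ι → Loc D → ℝ} {σb : Loc D → ℝ}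
    (hρ : ∀ i, rowVec ρl ρb i ≠ 0) (hσ : ∀ i, colVec σl σb i ≠ 0) (hU : IsUnit (arrowMat (X.scale ρl ρb σl σb))) (src : AIdx D ι → ℂ) :
    (arrowMat X)⁻¹ *ᵥ src =
      fun i => colVec σl σb i * ((arrowMat (X.scale ρl ρb σl σb))⁻¹ *ᵥ fun j => rowVec ρl ρb j * src j) i := by
  rw [inv_arrowMat_eq_of_scale X hρ hσ hU, ← mulVec_mulVec, ← mulVec_mulVec, diagonal_mulVec_eq, diagonal_mulVec_eq]

/-- [folklore] `|v ⬝ᵥ w| ≤ ‖v‖₂ ‖w‖₂` (plain dot product, no conjugation). -/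
theorem norm_dotProduct_le {n : Type*} [Fintype n] (v w : n → ℂ) :
    ‖v ⬝ᵥ w‖ ≤ ‖(toLp 2 v : EuclideanSpace ℂ n)‖ * ‖(toLp 2 w : EuclideanSpace ℂ n)‖ := by
  have h := norm_star_dotProduct_le (star v) (toLp 2 w)
  rw [star_star, ofLp_toLp, norm_toLp_star] at h
  exact h

/-- [folklore] **THE READOUT BOUND** (row F8 (ii)): with `F̃ = arrowMat (X.scale ρ σ)` invertible and `‖F̃⁻¹‖ ≤ A`,
`|read ⬝ᵥ (arrowMat X)⁻¹ src| ≤ ‖σ•read‖₂ · A · ‖ρ•src‖₂`.  Only the PRODUCT of the two weighted leg norms matters (R3 of the cut). -/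
theorem readout_le (X : ArrowData D ι) {ρl : ι → Loc D → ℝ} {ρb : Loc D → ℝ} {σl : ι → Loc D → ℝ} {σb : Loc D → ℝ}
    (hρ : ∀ i, rowVec ρl ρb i ≠ 0) (hσ : ∀ i, colVec σl σb i ≠ 0) (hU : IsUnit (arrowMat (X.scale ρl ρb σl σb))) {A : ℝ}
    (hA : ‖(arrowMat (X.scale ρl ρb σl σb))⁻¹‖ ≤ A) (read src : AIdx D ι → ℂ) :
    ‖read ⬝ᵥ ((arrowMat X)⁻¹ *ᵥ src)‖ ≤
      ‖(toLp 2 (fun i => colVec σl σb i * read i) : EuclideanSpace ℂ (AIdx D ι))‖ * A *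
        ‖(toLp 2 (fun j => rowVec ρl ρb j * src j) : EuclideanSpace ℂ (AIdx D ι))‖ := by
  rw [inv_mulVec_eq_of_scale X hρ hσ hU]
  set y : AIdx D ι → ℂ := (arrowMat (X.scale ρl ρb σl σb))⁻¹ *ᵥ fun j => rowVec ρl ρb j * src j with hy
  have hmove : read ⬝ᵥ (fun i => colVec σl σb i * y i) = (fun i => colVec σl σb i * read i) ⬝ᵥ y := by
    simp only [dotProduct]; exact Finset.sum_congr rfl fun i _ => by ring
  rw [hmove]
  refine (norm_dotProduct_le _ _).trans ?_
  have hy_le : ‖(toLp 2 y : EuclideanSpace ℂ (AIdx D ι))‖ ≤ A * ‖(toLp 2 (fun j => rowVec ρl ρb j * src j) : EuclideanSpace ℂ (AIdx D ι))‖ :=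
    (norm_toLp_mulVec_le _ _).trans (mul_le_mul_of_nonneg_right hA (norm_nonneg _))
  calc ‖(toLp 2 (fun i => colVec σl σb i * read i) : EuclideanSpace ℂ (AIdx D ι))‖ * ‖(toLp 2 y : EuclideanSpace ℂ (AIdx D ι))‖
      ≤ ‖(toLp 2 (fun i => colVec σl σb i * read i) : EuclideanSpace ℂ (AIdx D ι))‖ *
          (A * ‖(toLp 2 (fun j => rowVec ρl ρb j * src j) : EuclideanSpace ℂ (AIdx D ι))‖) := mul_le_mul_of_nonneg_left hy_le (norm_nonneg _)
    _ = _ := by ring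

end Unscale

/-- [folklore] **READOUT BOUND FOR THE CUT'S SCALING** (positive radii `r`, `r₀ > 0`): with `F̃ = arrowMat (scaledArrow N r r₀ p)` invertible, `‖F̃⁻¹‖ ≤ A`:
`|read ⬝ᵥ (arrowMat (aliasArrow N p))⁻¹ src| ≤ ‖colVec•read‖₂ · A · ‖rowVec•src‖₂` with the weights `rowLoc/rowBor/colLoc/colBor` of `ArrowScaling`. -/
theorem readout_le_scaled {r : TorusSite D N → ℝ} (hr : ∀ m, 0 < r m) {r0 : ℝ} (hr0 : 0 < r0) (p : Fin D → ℂ)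
    (hU : IsUnit (arrowMat (scaledArrow N r r0 p))) {A : ℝ} (hA : ‖(arrowMat (scaledArrow N r r0 p))⁻¹‖ ≤ A) (read src : AIdx D (TorusSite D N) → ℂ) :
    ‖read ⬝ᵥ ((arrowMat (aliasArrow N p))⁻¹ *ᵥ src)‖ ≤
      ‖(toLp 2 (fun i => colVec (colLoc N r) (colBor N r0) i * read i) : EuclideanSpace ℂ (AIdx D (TorusSite D N)))‖ * A *
        ‖(toLp 2 (fun j => rowVec (rowLoc N r) (rowBor D N r0) j * src j) : EuclideanSpace ℂ (AIdx D (TorusSite D N)))‖ :=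
  readout_le (aliasArrow N p) (rowVec_ne_zero hr hr0) (colVec_ne_zero hr hr0) hU hA read src

end Summit.QuantumFields.BalabanUV.Beta.GAN24.ArrowScalingInv

end
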